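import Literature.Topology.FourManifolds.SimplifiedBrokenLefschetzRoundSlicesIndex
import Literature.Topology.FourManifolds.CircleNormalFraming
import Literature.Topology.FourManifolds.GluckTwist
import HarnessLib

/-!
# The transverse Hessian of the vertical height along the round circle of a simplified broken
# Lefschetz fibration

Topic `Literature/Topology/FourManifolds`; groundwork (brick F3 of the fact seat's plan) for the
Morse–Bott tube of the round circle used in the proof of
`nonempty_diffeomorph_sphere_four_of_sblf_genus_one_noLefschetz`
(`SimplifiedBrokenLefschetzFibration.lean`; Baykur–Kamada 2015, §2 (arXiv p. 7) and §5 ¶1: the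
round locus is *"the fibrewise attachment of a round `1`-handle to the lower side"*, i.e. the
vertical height has a Morse–Bott critical circle of transverse index `1` along it).  Everything
here is **proved**; there are no definitions and no named facts.

Let `f : X → S²` be a Lefschetz-free SBLF on a closed oriented 4-manifold whose round image is
the equator, `Z` its round locus, `e : S¹ ↪ X` its longitude parametrisation
(`f (e u) = (u₀, u₁, 0)`), `ν : S¹ × ℝ³ ↪ X` an open tubular neighbourhood of `e`
(`ν (u, 0) = e u`), `v = (0, 0, σ)` the pole of the higher-genus side
(`exists_pole_lower_higher_sides`) and `g (t, x) = σ (f (ν (circlePt t, x)))₂` the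
**signed vertical height along the tube**, lifted to `ℝ × ℝ³`.

* `RoundTube.fderiv_apply_eq_zero_of_eventually`,
  `RoundTube.fderiv_fderiv_apply_eq_zero_of_eventually` — a function vanishing along a line
  through a point has vanishing first and second derivative along that line there.
* `RoundTube.exists_diffeomorph_apply_two_eq` — the rotation of `S²` about the polar axis
  taking a given point `(u₀, u₁, 0)` of the equator to `(1, 0, 0)`, as a diffeomorphism
  preserving the height `y₂` (Gluck's `rot_θ`, `GluckTwist.lean`); SBLF data transported along
  it (`comp_diffeomorph`): `image_round_diffeomorph_comp`, `lower_side_diffeomorph_comp`,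
  `higher_side_diffeomorph_comp`.
* `IsSimplifiedBrokenLefschetzFibration.roundHessian` — **the transverse Hessian of `g` along
  the zero section**: for every `t`, `g (t, 0) = 0`, `dg (t, 0) = 0`, and there are a linear
  automorphism `M` of `ℝ³` and `γ > 0` with
  `D²g (t, 0) ((0, a), (0, b)) = γ ((M a)₀ (M b)₀ + (M a)₁ (M b)₁ - (M a)₂ (M b)₂)`:
  the zero section `Z` is a nondegenerate (Morse–Bott) critical circle of the signed vertical
  height, of transverse index `1`, the negative direction pointing to the lower-genus side.
  In a fold chart `(φ, ψ)` of `f` at `e (circlePt t)` (Hayano 2011, Def. 2.1 (4)), after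
  rotating the base so that the chart point lies over `(1, 0, 0)`, `g = (Λ ∘ N) ∘ (φ ∘ ν̃)` with
  `N` the fold normal form and `Λ = σ y₂ ∘ ψ⁻¹` vanishing on the axis (the round image is the
  equator), so `D²g = 2 ∂ₛΛ · (dx₁² + dx₂² - dx₃²) ∘ D(φ ∘ ν̃)` on the normal directions
  (`fderiv_fderiv_comp_foldNormalForm_apply`, `SimplifiedBrokenLefschetzMorseCharts.lean`),
  `D(φ ∘ ν̃)` is injective with the `t`-direction tangent to the axis, and `σ ∂ₛΛ > 0` is the
  tree's `mul_fderiv_symm_pos_of_fold_chart` (`SimplifiedBrokenLefschetzRoundSlicesIndex.lean`: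
  the `s > 0` side of a fold chart is the higher-genus side).

## References

* R. İ. Baykur, S. Kamada, *Classification of broken Lefschetz fibrations with small fiber
  genera*, J. Math. Soc. Japan 67 (2015), §2, §5. [BaykurKamada2015]
* K. Hayano, *On genus-1 simplified broken Lefschetz fibrations*, Algebr. Geom. Topol. 11 (2011),
  Def. 2.1 (4). [Hayano2011]
* J. Milnor, *Morse theory* (1963), §2. [Milnor1963]
* H. Gluck, *The embedding of two-spheres in the four-sphere*, Trans. AMS 104 (1962), §8.
  [GluckTAMS1962]
-/

noncomputable section

open scoped Manifold ContDiff Topology Real RealInnerProductSpace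
open Set Function Filter Metric

namespace Literature.Topology.FourManifolds

universe u

/-! ### Tubular neighbourhoods of circles in a 4-manifold are local diffeomorphisms -/

/-- An open tubular neighbourhood `S¹ × ℝ³ ↪ X⁴` of a circle is a local diffeomorphism
(an equidimensional smooth embedding; Hirsch 1976, Ch. 1 §3). [cite: HirschDT1976, Ch. 1 §3] -/
theorem CircleNbhd.isLocalDiffeomorph {X : Type u} [TopologicalSpace X]
    [ChartedSpace (EuclideanSpace ℝ (Fin 4)) X] [IsManifold (𝓡 4) ∞ X]
    {c : Metric.sphere (0 : EuclideanSpace ℝ (Fin 2)) 1 → X} (ν : CircleNbhd (𝓡 4) c) :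
    IsLocalDiffeomorph ((𝓡 1).prod 𝓘(ℝ, EuclideanSpace ℝ (Fin 3))) (𝓡 4) ∞ ν.toFun := by
  intro q
  have hinj : Injective
      (mfderiv ((𝓡 1).prod 𝓘(ℝ, EuclideanSpace ℝ (Fin 3))) (𝓡 4) ν.toFun q) :=
    Manifold.IsImmersionAt.mfderiv_injective
      (ν.isSmoothEmbedding.isImmersion.isImmersionAt q) (by simp)
  let L₀ : (EuclideanSpace ℝ (Fin 1) × EuclideanSpace ℝ (Fin 3)) →ₗ[ℝ] EuclideanSpace ℝ (Fin 4) :=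
    show (EuclideanSpace ℝ (Fin 1) × EuclideanSpace ℝ (Fin 3)) →ₗ[ℝ] EuclideanSpace ℝ (Fin 4) from
      (mfderiv ((𝓡 1).prod 𝓘(ℝ, EuclideanSpace ℝ (Fin 3))) (𝓡 4) ν.toFun q).toLinearMap
  have hinj' : Injective L₀ := hinj
  have hsurj : Surjective L₀ :=
    (LinearMap.injective_iff_surjective_of_finrank_eq_finrank (by simp)).1 hinj'
  let L : (EuclideanSpace ℝ (Fin 1) × EuclideanSpace ℝ (Fin 3)) ≃L[ℝ] EuclideanSpace ℝ (Fin 4) :=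
    (LinearEquiv.ofBijective L₀ ⟨hinj', hsurj⟩).toContinuousLinearEquiv
  exact isLocalDiffeomorphAt_of_mfderiv isOpen_univ (mem_univ q)
    ν.isSmoothEmbedding.contMDiff.contMDiffOn (by simp) L (by ext v; rfl)


/-! ### Coordinates of the standard inclusion of the equator -/

/-- Coordinates of the standard inclusion `S¹ ↪ S²`, `u ↦ (u₀, u₁, 0)`. [folklore] -/
theorem coe_sphereInclusion_one_two_apply (u : Metric.sphere (0 : EuclideanSpace ℝ (Fin 2)) 1) :
    ((sphereInclusion 1 2 one_le_two u : Metric.sphere (0 : EuclideanSpace ℝ (Fin 3)) 1) :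
        EuclideanSpace ℝ (Fin 3)) 0 = (u : EuclideanSpace ℝ (Fin 2)) 0 ∧
      ((sphereInclusion 1 2 one_le_two u : Metric.sphere (0 : EuclideanSpace ℝ (Fin 3)) 1) :
        EuclideanSpace ℝ (Fin 3)) 1 = (u : EuclideanSpace ℝ (Fin 2)) 1 := by
  constructor <;> simp [sphereInclusion, euclideanInclusion_apply]



namespace RoundTube

/-! ### Derivatives along a line on which a function vanishes -/

section Analysis

variable {E : Type*} [NormedAddCommGroup E] [NormedSpace ℝ E]

/-- If `Λ (s • e₀) = 0` for `s` near `s₀` then `DΛ (s₀ • e₀) e₀ = 0`. [folklore] -/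
theorem fderiv_apply_eq_zero_of_eventually {Λ : E → ℝ} {e₀ : E} {s₀ : ℝ}
    (hΛ : DifferentiableAt ℝ Λ (s₀ • e₀)) (h0 : ∀ᶠ s in 𝓝 s₀, Λ (s • e₀) = 0) :
    fderiv ℝ Λ (s₀ • e₀) e₀ = 0 := by
  have hl : HasDerivAt (fun s : ℝ => s • e₀) e₀ s₀ := by
    simpa using (hasDerivAt_id s₀).smul_const e₀
  have h1 : HasDerivAt (fun s : ℝ => Λ (s • e₀)) (fderiv ℝ Λ (s₀ • e₀) e₀) s₀ :=
    hΛ.hasFDerivAt.comp_hasDerivAt s₀ hl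
  have h2 : HasDerivAt (fun s : ℝ => Λ (s • e₀)) 0 s₀ :=
    (hasDerivAt_const s₀ (0 : ℝ)).congr_of_eventuallyEq h0
  exact h1.unique h2

/-- If `Λ` is `C²` at `0` and `Λ (s • e₀) = 0` for `s` near `0` then `D²Λ (0) (e₀, e₀) = 0`.
[folklore] -/
theorem fderiv_fderiv_apply_eq_zero_of_eventually {Λ : E → ℝ} {e₀ : E}
    (hΛ : ContDiffAt ℝ 2 Λ 0) (h0 : ∀ᶠ s in 𝓝 (0 : ℝ), Λ (s • e₀) = 0) :
    fderiv ℝ (fderiv ℝ Λ) 0 e₀ e₀ = 0 := by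
  -- `Λ` is differentiable near `0`, hence at `s • e₀` for `s` near `0`
  have hd : ∀ᶠ y in 𝓝 (0 : E), DifferentiableAt ℝ Λ y :=
    (hΛ.eventually (by simp)).mono fun y hy => hy.differentiableAt (by simp)
  have hlc : ContinuousAt (fun s : ℝ => s • e₀) 0 := by fun_prop
  have hd' : ∀ᶠ s in 𝓝 (0 : ℝ), DifferentiableAt ℝ Λ (s • e₀) := by
    have hd0 : ∀ᶠ y in 𝓝 ((fun s : ℝ => s • e₀) 0), DifferentiableAt ℝ Λ y := by
      simpa using hd
    exact hlc.eventually hd0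
  -- so `s ↦ DΛ (s • e₀) e₀` vanishes near `0`
  have hzero : ∀ᶠ s in 𝓝 (0 : ℝ), fderiv ℝ Λ (s • e₀) e₀ = 0 := by
    filter_upwards [hd', h0.eventually_nhds] with s hs hs0
    exact fderiv_apply_eq_zero_of_eventually hs hs0
  -- differentiate it at `0`
  have hF : HasFDerivAt (fderiv ℝ Λ) (fderiv ℝ (fderiv ℝ Λ) 0) ((0 : ℝ) • e₀) := by
    rw [zero_smul]
    have h1 : ContDiffAt ℝ 1 (fderiv ℝ Λ) 0 := hΛ.fderiv_right (le_refl _)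
    exact (h1.differentiableAt (by simp)).hasFDerivAt
  have hl : HasDerivAt (fun s : ℝ => s • e₀) e₀ 0 := by
    simpa using (hasDerivAt_id (0 : ℝ)).smul_const e₀
  have hcomp : HasDerivAt (fun s : ℝ => fderiv ℝ Λ (s • e₀)) (fderiv ℝ (fderiv ℝ Λ) 0 e₀) 0 :=
    hF.comp_hasDerivAt 0 hl
  have happ : HasDerivAt (fun s : ℝ => fderiv ℝ Λ (s • e₀) e₀)
      (fderiv ℝ (fderiv ℝ Λ) 0 e₀ e₀ + fderiv ℝ Λ ((0 : ℝ) • e₀) 0) 0 :=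
    hcomp.clm_apply (hasDerivAt_const 0 e₀)
  rw [map_zero, add_zero] at happ
  have h2 : HasDerivAt (fun s : ℝ => fderiv ℝ Λ (s • e₀) e₀) 0 0 :=
    (hasDerivAt_const 0 (0 : ℝ)).congr_of_eventuallyEq hzero
  exact happ.unique h2

/-- A `C^∞` map `ℝ × F → ℝ` is `C^∞` for the product model. [folklore] -/
theorem contMDiff_prod_of_contDiff {F : Type*} [NormedAddCommGroup F] [NormedSpace ℝ F]
    {G : Type*} [NormedAddCommGroup G] [NormedSpace ℝ G]
    {g : ℝ × F → G} (hg : ContDiff ℝ ∞ g) :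
    ContMDiff (𝓘(ℝ, ℝ).prod 𝓘(ℝ, F)) 𝓘(ℝ, G) ∞ g := by
  have h := contMDiff_iff_contDiff.2 hg
  rw [modelWithCornersSelf_prod, ← chartedSpaceSelf_prod] at h
  exact h

/-- A `C^∞` map `ℝ × F → G` for the product model is `C^∞` in the vector-space sense.
[folklore] -/
theorem contDiff_of_contMDiff_prod {F : Type*} [NormedAddCommGroup F] [NormedSpace ℝ F]
    {G : Type*} [NormedAddCommGroup G] [NormedSpace ℝ G]
    {g : ℝ × F → G} (hg : ContMDiff (𝓘(ℝ, ℝ).prod 𝓘(ℝ, F)) 𝓘(ℝ, G) ∞ g) :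
    ContDiff ℝ ∞ g := by
  rw [← modelWithCornersSelf_prod, chartedSpaceSelf_prod] at hg
  exact contMDiff_iff_contDiff.1 hg

/-- A map `ℝ × F → G`, `C^n` at a point for the product model, is `C^n` there in the
vector-space sense. [folklore] -/
theorem contDiffAt_of_contMDiffAt_prod {F : Type*} [NormedAddCommGroup F] [NormedSpace ℝ F]
    {G : Type*} [NormedAddCommGroup G] [NormedSpace ℝ G] {g : ℝ × F → G} {q : ℝ × F}
    {n : WithTop ℕ∞} (hg : ContMDiffAt (𝓘(ℝ, ℝ).prod 𝓘(ℝ, F)) 𝓘(ℝ, G) n g q) :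
    ContDiffAt ℝ n g q := by
  rw [← modelWithCornersSelf_prod, chartedSpaceSelf_prod] at hg
  exact contMDiffAt_iff_contDiffAt.1 hg

/-- For a map `ℝ × F → G` the manifold derivative for the product model is the Fréchet
derivative. [folklore] -/
theorem mfderiv_prod_eq_fderiv {F : Type*} [NormedAddCommGroup F] [NormedSpace ℝ F]
    {G : Type*} [NormedAddCommGroup G] [NormedSpace ℝ G] (g : ℝ × F → G) (q : ℝ × F) :
    mfderiv (𝓘(ℝ, ℝ).prod 𝓘(ℝ, F)) 𝓘(ℝ, G) g q = fderiv ℝ g q := by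
  have key : mfderiv 𝓘(ℝ, ℝ × F) 𝓘(ℝ, G) g q = fderiv ℝ g q := mfderiv_eq_fderiv
  rw [modelWithCornersSelf_prod, ← chartedSpaceSelf_prod] at key
  exact key

end Analysis

/-! ### Rotating the base about the polar axis -/

section Rotation

/-- **A height-preserving diffeomorphism of `S²` moving a given point of the equator to
`(1, 0, 0)`**: the rotation about the polar axis through minus its longitude (Gluck 1962, §8,
`rotateSphereTwo`). [cite: GluckTAMS1962, §8] -/
theorem exists_diffeomorph_apply_two_eq (u : Metric.sphere (0 : EuclideanSpace ℝ (Fin 2)) 1) :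
    ∃ Ψ : Metric.sphere (0 : EuclideanSpace ℝ (Fin 3)) 1 ≃ₘ⟮𝓡 2, 𝓡 2⟯
        Metric.sphere (0 : EuclideanSpace ℝ (Fin 3)) 1,
      (∀ y, ((Ψ y : Metric.sphere (0 : EuclideanSpace ℝ (Fin 3)) 1) : EuclideanSpace ℝ (Fin 3)) 2
          = (y : EuclideanSpace ℝ (Fin 3)) 2) ∧
      ((Ψ (sphereInclusion 1 2 one_le_two u) : Metric.sphere (0 : EuclideanSpace ℝ (Fin 3)) 1) :
          EuclideanSpace ℝ (Fin 3)) 0 = 1 ∧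
      ((Ψ (sphereInclusion 1 2 one_le_two u) : Metric.sphere (0 : EuclideanSpace ℝ (Fin 3)) 1) :
          EuclideanSpace ℝ (Fin 3)) 1 = 0 := by
  -- the conjugate point `ū = (u₀, -u₁)` and the rotations by `ū` and `u`
  set ubar : Metric.sphere (0 : EuclideanSpace ℝ (Fin 2)) 1 := ⟨_, conj_mem_sphere u⟩ with hubar
  have hconj :
      (⟨_, conj_mem_sphere ubar⟩ : Metric.sphere (0 : EuclideanSpace ℝ (Fin 2)) 1) = u := by
    apply Subtype.ext
    ext i
    fin_cases i <;> simp [hubar]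
  have hu := norm_eq_of_mem_sphere u
  rw [EuclideanSpace.norm_eq, Real.sqrt_eq_one, Fin.sum_univ_two] at hu
  simp only [Real.norm_eq_abs, sq_abs] at hu
  let Ψ : Metric.sphere (0 : EuclideanSpace ℝ (Fin 3)) 1 ≃ₘ⟮𝓡 2, 𝓡 2⟯
      Metric.sphere (0 : EuclideanSpace ℝ (Fin 3)) 1 :=
    { toFun := rotateSphereTwo ubar
      invFun := rotateSphereTwo u
      left_inv := fun y => by
        have h := rotateSphereTwo_conj_rotateSphereTwo ubar y
        rwa [hconj] at h
      right_inv := fun y => rotateSphereTwo_conj_rotateSphereTwo u y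
      contMDiff_toFun := contMDiff_rotateSphereTwo_right ubar
      contMDiff_invFun := contMDiff_rotateSphereTwo_right u }
  refine ⟨Ψ, fun y => rotateSphereTwo_apply_two ubar y, ?_, ?_⟩
  · show (rotateSphereTwo ubar (sphereInclusion 1 2 one_le_two u) : EuclideanSpace ℝ (Fin 3)) 0 = 1
    rw [rotateSphereTwo_apply_zero, (coe_sphereInclusion_one_two_apply u).1,
      (coe_sphereInclusion_one_two_apply u).2]
    simp only [hubar]
    simp
    linear_combination hu
  · show (rotateSphereTwo ubar (sphereInclusion 1 2 one_le_two u) : EuclideanSpace ℝ (Fin 3)) 1 = 0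
    rw [rotateSphereTwo_apply_one, (coe_sphereInclusion_one_two_apply u).1,
      (coe_sphereInclusion_one_two_apply u).2]
    simp only [hubar]
    simp
    ring

/-- A height-preserving bijection of `S²` maps the equator onto the equator. [folklore] -/
theorem image_sphereEquator_eq_of_apply_two_eq
    (Ψ : Metric.sphere (0 : EuclideanSpace ℝ (Fin 3)) 1 ≃ₘ⟮𝓡 2, 𝓡 2⟯
      Metric.sphere (0 : EuclideanSpace ℝ (Fin 3)) 1)
    (hΨ : ∀ y, ((Ψ y : Metric.sphere (0 : EuclideanSpace ℝ (Fin 3)) 1) :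
      EuclideanSpace ℝ (Fin 3)) 2 = (y : EuclideanSpace ℝ (Fin 3)) 2) :
    Ψ '' sphereEquator 1 = sphereEquator 1 := by
  have hmem : ∀ y : Metric.sphere (0 : EuclideanSpace ℝ (Fin 3)) 1,
      y ∈ sphereEquator 1 ↔ (y : EuclideanSpace ℝ (Fin 3)) 2 = 0 := fun y => by
    rw [mem_sphereEquator_iff]; rfl
  ext y
  constructor
  · rintro ⟨x, hx, rfl⟩
    rw [hmem] at hx ⊢
    rw [hΨ, hx]
  · intro hy
    refine ⟨Ψ.symm y, ?_, Ψ.apply_symm_apply y⟩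
    rw [hmem] at hy ⊢
    rw [← hΨ, Ψ.apply_symm_apply, hy]

/-- For a pole `v = (0, 0, v₂)`: `⟪y, v⟫ = y₂ v₂`. [folklore] -/
theorem inner_eq_of_pole {v : EuclideanSpace ℝ (Fin 3)} (hv0 : v 0 = 0) (hv1 : v 1 = 0)
    (y : EuclideanSpace ℝ (Fin 3)) : ⟪y, v⟫ = y 2 * v 2 := by
  rw [EuclideanSpace.inner_eq_star_dotProduct]
  simp [dotProduct, Fin.sum_univ_three, hv0, hv1, mul_comm]

end Rotation

end RoundTube

namespace IsSimplifiedBrokenLefschetzFibration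

variable {X : Type u} [TopologicalSpace X] [ChartedSpace (EuclideanSpace ℝ (Fin 4)) X]
  [IsManifold (𝓡 4) ∞ X] {o : SmoothOrientation (𝓡 4) X}
  {f : X → (Metric.sphere (0 : EuclideanSpace ℝ (Fin 3)) 1)} {h : ℕ}

/-- **The round image is unchanged by a height-preserving diffeomorphism of the base** (it maps
the equator onto itself and the critical set of `Ψ ∘ f` is that of `f`). [folklore] -/
theorem image_round_diffeomorph_comp (hf : IsSimplifiedBrokenLefschetzFibration o f ∅ h)
    (hround : f '' ({p : X | ¬ Surjective (mfderiv (𝓡 4) (𝓡 2) f p)} \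
      (↑(∅ : Finset X) : Set X)) = sphereEquator 1)
    (Ψ : Metric.sphere (0 : EuclideanSpace ℝ (Fin 3)) 1 ≃ₘ⟮𝓡 2, 𝓡 2⟯
      Metric.sphere (0 : EuclideanSpace ℝ (Fin 3)) 1)
    (hΨ : ∀ y, ((Ψ y : Metric.sphere (0 : EuclideanSpace ℝ (Fin 3)) 1) :
      EuclideanSpace ℝ (Fin 3)) 2 = (y : EuclideanSpace ℝ (Fin 3)) 2) :
    (Ψ ∘ f) '' ({p : X | ¬ Surjective (mfderiv (𝓡 4) (𝓡 2) (Ψ ∘ f) p)} \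
      (↑(∅ : Finset X) : Set X)) = sphereEquator 1 := by
  have hfd : ∀ q, MDifferentiableAt (𝓡 4) (𝓡 2) f q := fun q =>
    (hf.contMDiff q).mdifferentiableAt (by simp)
  rw [setOf_not_surjective_diffeomorph_comp Ψ hfd, image_comp, hround,
    RoundTube.image_sphereEquator_eq_of_apply_two_eq Ψ hΨ]

/-- **The lower side is unchanged by a height-preserving diffeomorphism of the base.**
[folklore] -/
theorem lower_side_diffeomorph_comp (hf : IsSimplifiedBrokenLefschetzFibration o f ∅ h)
    (Ψ : Metric.sphere (0 : EuclideanSpace ℝ (Fin 3)) 1 ≃ₘ⟮𝓡 2, 𝓡 2⟯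
      Metric.sphere (0 : EuclideanSpace ℝ (Fin 3)) 1)
    (hΨ : ∀ y, ((Ψ y : Metric.sphere (0 : EuclideanSpace ℝ (Fin 3)) 1) :
      EuclideanSpace ℝ (Fin 3)) 2 = (y : EuclideanSpace ℝ (Fin 3)) 2)
    {v : Metric.sphere (0 : EuclideanSpace ℝ (Fin 3)) 1}
    (hv0 : (v : EuclideanSpace ℝ (Fin 3)) 0 = 0) (hv1 : (v : EuclideanSpace ℝ (Fin 3)) 1 = 0)
    {k : ℕ}
    (hlo : ∀ y : (Metric.sphere (0 : EuclideanSpace ℝ (Fin 3)) 1),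
      ⟪(y : EuclideanSpace ℝ (Fin 3)), (v : EuclideanSpace ℝ (Fin 3))⟫ < 0 →
        (∀ q, f q = y → Surjective (mfderiv (𝓡 4) (𝓡 2) f q)) ∧
        Nonempty ((Fin k → ℤ) ≃ₗ[ℤ]
          Literature.AlgebraicTopology.SingularHomology.singularHomology ℤ ℤ ↥(f ⁻¹' {y}) 1)) :
    ∀ y : (Metric.sphere (0 : EuclideanSpace ℝ (Fin 3)) 1),
      ⟪(y : EuclideanSpace ℝ (Fin 3)), (v : EuclideanSpace ℝ (Fin 3))⟫ < 0 →
        (∀ q, (Ψ ∘ f) q = y → Surjective (mfderiv (𝓡 4) (𝓡 2) (Ψ ∘ f) q)) ∧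
        Nonempty ((Fin k → ℤ) ≃ₗ[ℤ]
          Literature.AlgebraicTopology.SingularHomology.singularHomology ℤ ℤ
            ↥((Ψ ∘ f) ⁻¹' {y}) 1) := by
  have hfd : ∀ q, MDifferentiableAt (𝓡 4) (𝓡 2) f q := fun q =>
    (hf.contMDiff q).mdifferentiableAt (by simp)
  intro y hy
  have hy' : ⟪((Ψ.symm y : Metric.sphere (0 : EuclideanSpace ℝ (Fin 3)) 1) :
      EuclideanSpace ℝ (Fin 3)), (v : EuclideanSpace ℝ (Fin 3))⟫ < 0 := by
    rw [RoundTube.inner_eq_of_pole hv0 hv1] at hy ⊢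
    rwa [← hΨ (Ψ.symm y), Ψ.apply_symm_apply]
  obtain ⟨hreg, hgen⟩ := hlo (Ψ.symm y) hy'
  refine ⟨(forall_surjective_diffeomorph_comp_iff Ψ hfd y).2 hreg, ?_⟩
  rw [preimage_diffeomorph_comp_singleton]
  exact hgen


/-! ### The transverse Hessian along the round circle -/

/-- **The transverse Hessian of the signed vertical height along the round circle.**  Let
`f : X → S²` be a Lefschetz-free SBLF on a closed oriented 4-manifold with equatorial round
image, `v = (0, 0, σ)` the pole of its higher side (`hlo`, `hhi` as produced by
`exists_pole_lower_higher_sides`), `e` the longitude parametrisation of the round locus `Z`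
(`range e = Z`, `f (e u) = (u₀, u₁, 0)`) and `ν : S¹ × ℝ³ ↪ X` any open tubular neighbourhood of
`e`.  Put `g (t, x) = σ (f (ν (circlePt t, x)))₂`.  Then for every `t`: `g (t, 0) = 0`,
`dg (t, 0) = 0`, and there are a linear automorphism `M` of `ℝ³` and `γ > 0` with
`D²g (t, 0) ((0, a), (0, b)) = γ ((M a)₀ (M b)₀ + (M a)₁ (M b)₁ - (M a)₂ (M b)₂)` for all
`a b : ℝ³` — the round circle is a Morse–Bott critical circle of the signed vertical height of
transverse index `1` (the fold model of Hayano 2011, Def. 2.1 (4), read through the fold chart;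
Baykur–Kamada 2015, §2: the round singularity is a fibrewise round `1`-handle attached to the
lower side). [cite: BaykurKamada2015, §2 (arXiv p. 7), §5] [cite: Hayano2011, Def. 2.1 (4)]
[cite: Milnor1963, §2] -/
theorem roundHessian [T2Space X] [SecondCountableTopology X] [CompactSpace X]
    (hf : IsSimplifiedBrokenLefschetzFibration o f ∅ h)
    (hround : f '' ({p : X | ¬ Surjective (mfderiv (𝓡 4) (𝓡 2) f p)} \
      (↑(∅ : Finset X) : Set X)) = sphereEquator 1)
    {v : Metric.sphere (0 : EuclideanSpace ℝ (Fin 3)) 1}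
    (hv0 : (v : EuclideanSpace ℝ (Fin 3)) 0 = 0) (hv1 : (v : EuclideanSpace ℝ (Fin 3)) 1 = 0)
    (hlo : ∀ y : (Metric.sphere (0 : EuclideanSpace ℝ (Fin 3)) 1),
      ⟪(y : EuclideanSpace ℝ (Fin 3)), (v : EuclideanSpace ℝ (Fin 3))⟫ < 0 →
        (∀ q, f q = y → Surjective (mfderiv (𝓡 4) (𝓡 2) f q)) ∧
        Nonempty ((Fin (2 * h) → ℤ) ≃ₗ[ℤ]
          Literature.AlgebraicTopology.SingularHomology.singularHomology ℤ ℤ ↥(f ⁻¹' {y}) 1))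
    (hhi : ∀ y : (Metric.sphere (0 : EuclideanSpace ℝ (Fin 3)) 1),
      ⟪(y : EuclideanSpace ℝ (Fin 3)),
          ((-v : (Metric.sphere (0 : EuclideanSpace ℝ (Fin 3)) 1)) : EuclideanSpace ℝ (Fin 3))⟫
          < 0 →
        (∀ q, f q = y → Surjective (mfderiv (𝓡 4) (𝓡 2) f q)) ∧
        Nonempty ((Fin (2 * (h + 1)) → ℤ) ≃ₗ[ℤ]
          Literature.AlgebraicTopology.SingularHomology.singularHomology ℤ ℤ ↥(f ⁻¹' {y}) 1))
    {e : Metric.sphere (0 : EuclideanSpace ℝ (Fin 2)) 1 → X}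
    (hrange : range e = {p : X | ¬ Surjective (mfderiv (𝓡 4) (𝓡 2) f p)} \
      (↑(∅ : Finset X) : Set X))
    (hfe : ∀ u, f (e u) = sphereInclusion 1 2 one_le_two u) (ν : CircleNbhd (𝓡 4) e)
    {g : ℝ × EuclideanSpace ℝ (Fin 3) → ℝ}
    (hg : ∀ q, g q = (v : EuclideanSpace ℝ (Fin 3)) 2 *
      (f (ν.toFun (circlePt q.1, q.2)) : EuclideanSpace ℝ (Fin 3)) 2) (t : ℝ) :
    g (t, 0) = 0 ∧ fderiv ℝ g (t, 0) = 0 ∧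
      ∃ (M : EuclideanSpace ℝ (Fin 3) ≃L[ℝ] EuclideanSpace ℝ (Fin 3)) (γ : ℝ), 0 < γ ∧
        ∀ a b : EuclideanSpace ℝ (Fin 3),
          fderiv ℝ (fderiv ℝ g) (t, 0) ((0 : ℝ), a) ((0 : ℝ), b) =
            γ * ((M a) 0 * (M b) 0 + (M a) 1 * (M b) 1 - (M a) 2 * (M b) 2) := by
  have h1' : (1 : ℕ∞ω) ≤ ∞ := by exact_mod_cast le_top
  have hfd : ∀ q, MDifferentiableAt (𝓡 4) (𝓡 2) f q := fun q =>
    (hf.contMDiff q).mdifferentiableAt (by simp)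
  /- Step 1: rotate the base so that `f (e (circlePt t))` becomes `(1, 0, 0)`. -/
  obtain ⟨Ψ, hΨ2, -, hΨ1⟩ := RoundTube.exists_diffeomorph_apply_two_eq (circlePt t)
  have hf' : IsSimplifiedBrokenLefschetzFibration o (Ψ ∘ f) ∅ h := hf.comp_diffeomorph Ψ
  have hf'd : ∀ q, MDifferentiableAt (𝓡 4) (𝓡 2) (Ψ ∘ f) q := fun q =>
    (hf'.contMDiff q).mdifferentiableAt (by simp)
  have hround' := hf.image_round_diffeomorph_comp hround Ψ hΨ2
  have hlo' := hf.lower_side_diffeomorph_comp Ψ hΨ2 hv0 hv1 hlo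
  have hnv0 : ((-v : (Metric.sphere (0 : EuclideanSpace ℝ (Fin 3)) 1)) :
      EuclideanSpace ℝ (Fin 3)) 0 = 0 := by
    rw [coe_neg_sphere]; simp [hv0]
  have hnv1 : ((-v : (Metric.sphere (0 : EuclideanSpace ℝ (Fin 3)) 1)) :
      EuclideanSpace ℝ (Fin 3)) 1 = 0 := by
    rw [coe_neg_sphere]; simp [hv1]
  have hhi' := hf.lower_side_diffeomorph_comp Ψ hΨ2 hnv0 hnv1 hhi
  /- Step 2: a fold chart of `Ψ ∘ f` at the round point `z = e (circlePt t)`. -/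
  have hzcrit : ¬ Surjective (mfderiv (𝓡 4) (𝓡 2) f (e (circlePt t))) := by
    have hz : e (circlePt t) ∈ range e := ⟨circlePt t, rfl⟩
    rw [hrange] at hz
    exact hz.1
  have hzcrit' : ¬ Surjective (mfderiv (𝓡 4) (𝓡 2) (Ψ ∘ f) (e (circlePt t))) := by
    rwa [surjective_mfderiv_diffeomorph_comp_iff Ψ (hfd _)]
  obtain ⟨φ, ψ, hzφ, hφz, hmaps, hφ, hφs, hψ, hψs, hmodel⟩ :=
    hf'.fold (e (circlePt t)) hzcrit' (Finset.notMem_empty _)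
  have hz1 : (((Ψ ∘ f) (e (circlePt t)) : Metric.sphere (0 : EuclideanSpace ℝ (Fin 3)) 1) :
      EuclideanSpace ℝ (Fin 3)) 1 = 0 := by
    show ((Ψ (f (e (circlePt t))) : Metric.sphere (0 : EuclideanSpace ℝ (Fin 3)) 1) :
      EuclideanSpace ℝ (Fin 3)) 1 = 0
    rw [hfe]
    exact hΨ1
  /- Step 3: the sign `σ ∂ₛΓ₂ (0) > 0` (the `s > 0` side of the fold chart is the higher side). -/
  have hpos := hf'.mul_fderiv_symm_pos_of_fold_chart hround' hv0 hv1 hlo' hhi' hz1 hzφ hφz hmaps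
    hφ hφs hψ hψs hmodel
  /- Step 4: the players `ν̃`, `J = φ ∘ ν̃`, the normal form `N`, `Λ = σ y₂ ∘ ψ⁻¹`. -/
  obtain ⟨νt, hνt⟩ : ∃ νt : ℝ × EuclideanSpace ℝ (Fin 3) → X,
      νt = fun q => ν.toFun (circlePt q.1, q.2) := ⟨_, rfl⟩
  obtain ⟨J, hJ⟩ : ∃ J : ℝ × EuclideanSpace ℝ (Fin 3) → EuclideanSpace ℝ (Fin 4),
      J = fun q => φ (νt q) := ⟨_, rfl⟩
  obtain ⟨N, hN⟩ : ∃ N : EuclideanSpace ℝ (Fin 4) → EuclideanSpace ℝ (Fin 2),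
      N = fun w => (WithLp.toLp 2 ![w 0, w 1 ^ 2 + w 2 ^ 2 - w 3 ^ 2] :
        EuclideanSpace ℝ (Fin 2)) := ⟨_, rfl⟩
  obtain ⟨ℓ, hℓ⟩ : ∃ ℓ : Metric.sphere (0 : EuclideanSpace ℝ (Fin 3)) 1 → ℝ,
      ℓ = fun y : Metric.sphere (0 : EuclideanSpace ℝ (Fin 3)) 1 =>
        (v : EuclideanSpace ℝ (Fin 3)) 2 * (y : EuclideanSpace ℝ (Fin 3)) 2 := ⟨_, rfl⟩
  have hνt0 : νt (t, 0) = e (circlePt t) := by rw [hνt]; exact ν.apply_zero _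
  have hJ0 : J (t, 0) = 0 := by rw [hJ]; show φ (νt (t, 0)) = 0; rw [hνt0, hφz]
  have hN0 : N 0 = 0 := by
    rw [hN]; ext i; fin_cases i <;> simp
  have haxis0 : (0 : EuclideanSpace ℝ (Fin 4)) 1 = 0 ∧ (0 : EuclideanSpace ℝ (Fin 4)) 2 = 0 ∧
      (0 : EuclideanSpace ℝ (Fin 4)) 3 = 0 := by simp
  have h0tgt : (0 : EuclideanSpace ℝ (Fin 2)) ∈ ψ.target := by
    have h1 := apply_eq_foldNormalForm_of_fold_chart hmodel hzφ
    rw [← hN, hφz, hN0] at h1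
    rw [← h1]
    exact ψ.map_source (hmaps hzφ)
  -- smoothness
  have hνtM : ContMDiff (𝓘(ℝ, ℝ).prod 𝓘(ℝ, EuclideanSpace ℝ (Fin 3))) (𝓡 4) ∞ νt := by
    rw [hνt]
    exact ν.isSmoothEmbedding.contMDiff.comp (contMDiff_circlePt.prodMap contMDiff_id)
  have hgs : ContDiff ℝ ∞ g := by
    haveI : Fact (Module.finrank ℝ (EuclideanSpace ℝ (Fin 3)) = 2 + 1) :=
      ⟨finrank_euclideanSpace_fin⟩
    have h1 : ContMDiff (𝓘(ℝ, ℝ).prod 𝓘(ℝ, EuclideanSpace ℝ (Fin 3)))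
        𝓘(ℝ, EuclideanSpace ℝ (Fin 3)) ∞
        (fun q => (f (νt q) : EuclideanSpace ℝ (Fin 3))) :=
      (contMDiff_coe_sphere (n := 2) (E := EuclideanSpace ℝ (Fin 3))).comp
        (hf.contMDiff.comp hνtM)
    have h2 : ContDiff ℝ ∞ fun q => (f (νt q) : EuclideanSpace ℝ (Fin 3)) 2 :=
      contDiff_euclidean.1 (RoundTube.contDiff_of_contMDiff_prod h1) 2
    have h3 : g = fun q => (v : EuclideanSpace ℝ (Fin 3)) 2 *
        (f (νt q) : EuclideanSpace ℝ (Fin 3)) 2 := by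
      funext q; rw [hg, hνt]
    rw [h3]
    exact contDiff_const.mul h2
  have hzsrc : νt (t, 0) ∈ φ.source := by rw [hνt0]; exact hzφ
  have hJM : ContMDiffAt (𝓘(ℝ, ℝ).prod 𝓘(ℝ, EuclideanSpace ℝ (Fin 3))) (𝓡 4) ∞ J (t, 0) := by
    rw [hJ]
    exact ((hφ _ hzsrc).contMDiffAt (φ.open_source.mem_nhds hzsrc)).comp (t, 0)
      hνtM.contMDiffAt
  have hJs : ContDiffAt ℝ ∞ J (t, 0) := RoundTube.contDiffAt_of_contMDiffAt_prod hJM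
  have hℓM : ContMDiff (𝓡 2) 𝓘(ℝ, ℝ) ∞ ℓ := by
    haveI : Fact (Module.finrank ℝ (EuclideanSpace ℝ (Fin 3)) = 2 + 1) :=
      ⟨finrank_euclideanSpace_fin⟩
    rw [hℓ]
    exact contMDiff_const.mul
      ((EuclideanSpace.proj (2 : Fin 3)).contDiff.comp_contMDiff
        (contMDiff_coe_sphere (n := 2) (E := EuclideanSpace ℝ (Fin 3))))
  have hΛs : ContDiffAt ℝ ∞ (ℓ ∘ ψ.symm) 0 := contDiffAt_comp_symm_of_chart hψs hℓM h0tgt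
  have hΓs : ContDiffAt ℝ ∞ (fun w => ((ψ.symm w : Metric.sphere (0 : EuclideanSpace ℝ (Fin 3))
      1) : EuclideanSpace ℝ (Fin 3))) 0 := by
    haveI : Fact (Module.finrank ℝ (EuclideanSpace ℝ (Fin 3)) = 2 + 1) :=
      ⟨finrank_euclideanSpace_fin⟩
    have h1 : ContMDiffAt (𝓡 2) (𝓡 2) ∞ ψ.symm 0 :=
      (hψs 0 h0tgt).contMDiffAt (ψ.open_target.mem_nhds h0tgt)
    exact contMDiffAt_iff_contDiffAt.1
      ((contMDiff_coe_sphere (n := 2) (E := EuclideanSpace ℝ (Fin 3))).contMDiffAt.comp 0 h1)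
  have hNs : ContDiff ℝ ∞ N := by rw [hN]; exact contDiff_foldNormalForm
  have hΛNs : ContDiffAt ℝ ∞ ((ℓ ∘ ψ.symm) ∘ N) (J (t, 0)) := by
    rw [hJ0]
    refine ContDiffAt.comp 0 ?_ hNs.contDiffAt
    rw [hN0]
    exact hΛs
  /- Step 5: `g = (Λ ∘ N) ∘ J` near `(t, 0)`. -/
  have hUo : IsOpen {q : ℝ × EuclideanSpace ℝ (Fin 3) | νt q ∈ φ.source} :=
    φ.open_source.preimage hνtM.continuous
  have heq : g =ᶠ[𝓝 (t, 0)] ((ℓ ∘ ψ.symm) ∘ N) ∘ J := by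
    filter_upwards [hUo.mem_nhds hzsrc] with q hq
    have h1 := apply_eq_foldNormalForm_of_fold_chart hmodel hq
    rw [← hN] at h1
    show g q = ℓ (ψ.symm (N (J q)))
    rw [hJ]
    show g q = ℓ (ψ.symm (N (φ (νt q))))
    rw [← h1, ψ.left_inv (hmaps hq), hℓ, hg, hνt]
    show (v : EuclideanSpace ℝ (Fin 3)) 2 *
        (f (ν.toFun (circlePt q.1, q.2)) : EuclideanSpace ℝ (Fin 3)) 2 =
      (v : EuclideanSpace ℝ (Fin 3)) 2 *
        ((Ψ (f (ν.toFun (circlePt q.1, q.2))) : Metric.sphere (0 : EuclideanSpace ℝ (Fin 3))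
          1) : EuclideanSpace ℝ (Fin 3)) 2
    rw [hΨ2]
  /- Step 6: `Λ` vanishes on the axis near `0`. -/
  have haxis : ∀ᶠ s in 𝓝 (0 : ℝ),
      (ℓ ∘ ψ.symm) (s • EuclideanSpace.single (0 : Fin 2) (1 : ℝ)) = 0 := by
    have h0t : (0 : EuclideanSpace ℝ (Fin 4)) ∈ φ.target := by
      rw [← hφz]; exact φ.map_source hzφ
    have hc : ContinuousAt (fun s : ℝ => s • EuclideanSpace.single (0 : Fin 4) (1 : ℝ)) 0 := by
      fun_prop
    have hev : ∀ᶠ s in 𝓝 (0 : ℝ), s • EuclideanSpace.single (0 : Fin 4) (1 : ℝ) ∈ φ.target := by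
      refine hc.preimage_mem_nhds ?_
      rw [zero_smul]
      exact φ.open_target.mem_nhds h0t
    filter_upwards [hev] with s hs
    have hp : φ.symm (s • EuclideanSpace.single (0 : Fin 4) (1 : ℝ)) ∈ φ.source :=
      φ.map_target hs
    have hφp : φ (φ.symm (s • EuclideanSpace.single (0 : Fin 4) (1 : ℝ))) =
        s • EuclideanSpace.single (0 : Fin 4) (1 : ℝ) := φ.right_inv hs
    have hpcrit : ¬ Surjective (mfderiv (𝓡 4) (𝓡 2) (Ψ ∘ f)
        (φ.symm (s • EuclideanSpace.single (0 : Fin 4) (1 : ℝ)))) := by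
      rw [surjective_mfderiv_iff_of_fold_chart hmaps (hφ.of_le h1') (hφs.of_le h1')
        (hψ.of_le h1') (hψs.of_le h1') hmodel hp (hf'd _), not_not, hφp]
      simp
    have hpeq : (Ψ ∘ f) (φ.symm (s • EuclideanSpace.single (0 : Fin 4) (1 : ℝ))) ∈
        sphereEquator 1 := by
      rw [← hround']
      exact ⟨_, ⟨hpcrit, by simp⟩, rfl⟩
    have hp2 : (((Ψ ∘ f) (φ.symm (s • EuclideanSpace.single (0 : Fin 4) (1 : ℝ))) :
        Metric.sphere (0 : EuclideanSpace ℝ (Fin 3)) 1) : EuclideanSpace ℝ (Fin 3)) 2 = 0 := by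
      rw [mem_sphereEquator_iff] at hpeq
      exact hpeq
    have hNw : N (s • EuclideanSpace.single (0 : Fin 4) (1 : ℝ)) =
        s • EuclideanSpace.single (0 : Fin 2) (1 : ℝ) := by
      rw [hN]; ext i; fin_cases i <;> simp
    have hψp := apply_eq_foldNormalForm_of_fold_chart hmodel hp
    rw [← hN, hφp, hNw] at hψp
    show ℓ (ψ.symm (s • EuclideanSpace.single (0 : Fin 2) (1 : ℝ))) = 0
    rw [← hψp, ψ.left_inv (hmaps hp), hℓ]
    show (v : EuclideanSpace ℝ (Fin 3)) 2 * _ = 0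
    rw [hp2, mul_zero]
  /- Step 7: hence `∂ₜΛ (0) = 0`, `∂ₜₜΛ (0) = 0`, and `D(Λ ∘ N) (0) = 0`. -/
  have hΛd : DifferentiableAt ℝ (ℓ ∘ ψ.symm) 0 := hΛs.differentiableAt (by simp)
  have hD1 : fderiv ℝ (ℓ ∘ ψ.symm) 0 (EuclideanSpace.single (0 : Fin 2) (1 : ℝ)) = 0 := by
    have h1 := RoundTube.fderiv_apply_eq_zero_of_eventually (s₀ := 0)
      (e₀ := EuclideanSpace.single (0 : Fin 2) (1 : ℝ)) (Λ := ℓ ∘ ψ.symm)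
      (by rw [zero_smul]; exact hΛd) haxis
    rwa [zero_smul] at h1
  have hD2 : fderiv ℝ (fderiv ℝ (ℓ ∘ ψ.symm)) 0 (EuclideanSpace.single (0 : Fin 2) (1 : ℝ))
      (EuclideanSpace.single (0 : Fin 2) (1 : ℝ)) = 0 :=
    RoundTube.fderiv_fderiv_apply_eq_zero_of_eventually (hΛs.of_le (by norm_cast)) haxis
  have hcrit : fderiv ℝ ((ℓ ∘ ψ.symm) ∘ N) 0 = 0 := by
    ext w
    have key := fderiv_comp_foldNormalForm_apply (Λ := ℓ ∘ ψ.symm) (u := 0)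
      (by rw [← hN, hN0]; exact hΛd) haxis0 w
    rw [← hN] at key
    rw [key, hN0, hD1, mul_zero, zero_apply]
  /- Step 8: `dg (t, 0) = 0` and `g (t, 0) = 0`. -/
  have hg0 : g (t, 0) = 0 := by
    rw [hg]
    show (v : EuclideanSpace ℝ (Fin 3)) 2 *
      (f (ν.toFun (circlePt t, 0)) : EuclideanSpace ℝ (Fin 3)) 2 = 0
    rw [ν.apply_zero, hfe]
    simp [sphereInclusion, euclideanInclusion_apply]
  have hgd1 : fderiv ℝ g (t, 0) = 0 := by
    rw [heq.fderiv_eq, fderiv_comp (t, 0) (hΛNs.differentiableAt (by simp))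
      (hJs.differentiableAt (by simp)), hJ0, hcrit, ContinuousLinearMap.zero_comp]
  /- Step 9: the second derivative in terms of `V a = DJ (t, 0) (0, a)`. -/
  have hβ : fderiv ℝ (ℓ ∘ ψ.symm) 0 (EuclideanSpace.single (1 : Fin 2) (1 : ℝ)) =
      (v : EuclideanSpace ℝ (Fin 3)) 2 *
        fderiv ℝ (fun w => ((ψ.symm w : Metric.sphere (0 : EuclideanSpace ℝ (Fin 3)) 1) :
          EuclideanSpace ℝ (Fin 3))) 0 (EuclideanSpace.single (1 : Fin 2) (1 : ℝ)) 2 := by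
    have hout : HasFDerivAt (fun y : EuclideanSpace ℝ (Fin 3) =>
        (v : EuclideanSpace ℝ (Fin 3)) 2 * y 2)
        (((v : EuclideanSpace ℝ (Fin 3)) 2) • EuclideanSpace.proj (𝕜 := ℝ) (2 : Fin 3))
        (((ψ.symm 0 : Metric.sphere (0 : EuclideanSpace ℝ (Fin 3)) 1) :
          EuclideanSpace ℝ (Fin 3))) := by
      have hfn : (fun y : EuclideanSpace ℝ (Fin 3) => (v : EuclideanSpace ℝ (Fin 3)) 2 * y 2) =
          ⇑(((v : EuclideanSpace ℝ (Fin 3)) 2) • EuclideanSpace.proj (𝕜 := ℝ) (2 : Fin 3)) := by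
        funext y
        simp
      rw [hfn]
      exact ContinuousLinearMap.hasFDerivAt _
    have hcomp := hout.comp (0 : EuclideanSpace ℝ (Fin 2))
      (hΓs.differentiableAt (by simp)).hasFDerivAt
    have hfun : (ℓ ∘ ψ.symm) = (fun y : EuclideanSpace ℝ (Fin 3) =>
        (v : EuclideanSpace ℝ (Fin 3)) 2 * y 2) ∘ (fun w => ((ψ.symm w :
          Metric.sphere (0 : EuclideanSpace ℝ (Fin 3)) 1) : EuclideanSpace ℝ (Fin 3))) := by
      funext w; rw [hℓ]; rfl
    rw [hfun, hcomp.fderiv]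
    simp
  have hγpos : 0 < 2 * fderiv ℝ (ℓ ∘ ψ.symm) 0 (EuclideanSpace.single (1 : Fin 2) (1 : ℝ)) := by
    rw [hβ]; positivity
  have hD2g : ∀ a b : EuclideanSpace ℝ (Fin 3),
      fderiv ℝ (fderiv ℝ g) (t, 0) ((0 : ℝ), a) ((0 : ℝ), b) =
        fderiv ℝ (ℓ ∘ ψ.symm) 0 (EuclideanSpace.single (1 : Fin 2) (1 : ℝ)) *
          (2 * (fderiv ℝ J (t, 0) ((0 : ℝ), a) 1 * fderiv ℝ J (t, 0) ((0 : ℝ), b) 1 +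
            fderiv ℝ J (t, 0) ((0 : ℝ), a) 2 * fderiv ℝ J (t, 0) ((0 : ℝ), b) 2 -
            fderiv ℝ J (t, 0) ((0 : ℝ), a) 3 * fderiv ℝ J (t, 0) ((0 : ℝ), b) 3)) := by
    intro a b
    rw [(heq.fderiv).fderiv_eq,
      fderiv_fderiv_comp_apply_of_fderiv_eq_zero (hΛNs.of_le (by norm_cast))
        (hJs.of_le (by norm_cast)) (by rw [hJ0]; exact hcrit), hJ0]
    have key := fderiv_fderiv_comp_foldNormalForm_apply (Λ := ℓ ∘ ψ.symm) (u := 0)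
      (by rw [← hN, hN0]; exact hΛs.of_le (by norm_cast)) haxis0
      (fderiv ℝ J (t, 0) ((0 : ℝ), a)) (fderiv ℝ J (t, 0) ((0 : ℝ), b))
    rw [← hN] at key
    rw [key, hN0, hD2, zero_mul, zero_add]
  /- Step 10: `DJ (t, 0)` is injective and `DJ (t, 0) (1, 0)` is tangent to the axis. -/
  have hJinj : Injective (fderiv ℝ J (t, 0)) := by
    -- `φ ∘ ν` is a local diffeomorphism of `S¹ × ℝ³` at `(circlePt t, 0)`
    let Φ : PartialDiffeomorph (𝓡 4) (𝓡 4) X (EuclideanSpace ℝ (Fin 4)) ∞ :=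
      { toPartialEquiv := φ.toPartialEquiv
        open_source := φ.open_source
        open_target := φ.open_target
        contMDiffOn_toFun := hφ
        contMDiffOn_invFun := hφs }
    have hφld : IsLocalDiffeomorphAt (𝓡 4) (𝓡 4) ∞ φ (ν.toFun (circlePt t, 0)) := by
      rw [ν.apply_zero]
      exact Φ.isLocalDiffeomorphAt (𝓡 4) (𝓡 4) ∞ hzφ
    have hJb : IsLocalDiffeomorphAt ((𝓡 1).prod 𝓘(ℝ, EuclideanSpace ℝ (Fin 3))) (𝓡 4) ∞
        (φ ∘ ν.toFun) (circlePt t, 0) :=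
      (ν.isLocalDiffeomorph (circlePt t, 0)).comp (K := 𝓡 4) (P := EuclideanSpace ℝ (Fin 4))
        hφld
    have hLinj : Injective (mfderiv ((𝓡 1).prod 𝓘(ℝ, EuclideanSpace ℝ (Fin 3))) (𝓡 4)
        (φ ∘ ν.toFun) (circlePt t, 0)) := by
      exact (hJb.mfderivToContinuousLinearEquiv (by simp)).injective
    -- `(s, x) ↦ (circlePt s, x)` has injective differential: it has a smooth local left inverse
    have hPd : MDifferentiableAt (𝓘(ℝ, ℝ).prod 𝓘(ℝ, EuclideanSpace ℝ (Fin 3)))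
        ((𝓡 1).prod 𝓘(ℝ, EuclideanSpace ℝ (Fin 3)))
        (Prod.map circlePt (id : EuclideanSpace ℝ (Fin 3) → EuclideanSpace ℝ (Fin 3))) (t, 0) :=
      (contMDiff_circlePt.contMDiffAt.mdifferentiableAt (by simp)).prodMap mdifferentiableAt_id
    have hPinj : Injective (mfderiv (𝓘(ℝ, ℝ).prod 𝓘(ℝ, EuclideanSpace ℝ (Fin 3)))
        ((𝓡 1).prod 𝓘(ℝ, EuclideanSpace ℝ (Fin 3)))
        (Prod.map circlePt (id : EuclideanSpace ℝ (Fin 3) → EuclideanSpace ℝ (Fin 3))) (t, 0)) := by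
      obtain ⟨ang, hang, hsec⟩ := exists_local_section_circlePt t
      have hL : MDifferentiableAt ((𝓡 1).prod 𝓘(ℝ, EuclideanSpace ℝ (Fin 3)))
          (𝓘(ℝ, ℝ).prod 𝓘(ℝ, EuclideanSpace ℝ (Fin 3)))
          (Prod.map ang (id : EuclideanSpace ℝ (Fin 3) → EuclideanSpace ℝ (Fin 3)))
          (Prod.map circlePt (id : EuclideanSpace ℝ (Fin 3) → EuclideanSpace ℝ (Fin 3)) (t, 0)) :=
        (hang.mdifferentiableAt (by simp)).prodMap mdifferentiableAt_id
      have hcomp := mfderiv_comp (t, 0) hL hPd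
      have hev : (Prod.map ang (id : EuclideanSpace ℝ (Fin 3) → EuclideanSpace ℝ (Fin 3)) ∘
          Prod.map circlePt (id : EuclideanSpace ℝ (Fin 3) → EuclideanSpace ℝ (Fin 3))) =ᶠ[𝓝 (t, 0)]
          id := by
        have h1 : ∀ᶠ q : ℝ × EuclideanSpace ℝ (Fin 3) in 𝓝 (t, 0), ang (circlePt q.1) = q.1 :=
          (continuousAt_fst (p := ((t, 0) : ℝ × EuclideanSpace ℝ (Fin 3)))).eventually hsec
        filter_upwards [h1] with q hq
        show (ang (circlePt q.1), id q.2) = q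
        rw [hq]
        rfl
      have hid : mfderiv (𝓘(ℝ, ℝ).prod 𝓘(ℝ, EuclideanSpace ℝ (Fin 3)))
          (𝓘(ℝ, ℝ).prod 𝓘(ℝ, EuclideanSpace ℝ (Fin 3)))
          (Prod.map ang (id : EuclideanSpace ℝ (Fin 3) → EuclideanSpace ℝ (Fin 3)) ∘
            Prod.map circlePt (id : EuclideanSpace ℝ (Fin 3) → EuclideanSpace ℝ (Fin 3))) (t, 0) =
          mfderiv (𝓘(ℝ, ℝ).prod 𝓘(ℝ, EuclideanSpace ℝ (Fin 3)))
            (𝓘(ℝ, ℝ).prod 𝓘(ℝ, EuclideanSpace ℝ (Fin 3))) id (t, 0) := hev.mfderiv_eq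
      rw [mfderiv_id, hcomp] at hid
      intro p q hpq
      have h2 := congrArg (mfderiv ((𝓡 1).prod 𝓘(ℝ, EuclideanSpace ℝ (Fin 3)))
        (𝓘(ℝ, ℝ).prod 𝓘(ℝ, EuclideanSpace ℝ (Fin 3)))
        (Prod.map ang (id : EuclideanSpace ℝ (Fin 3) → EuclideanSpace ℝ (Fin 3)))
        (Prod.map circlePt (id : EuclideanSpace ℝ (Fin 3) → EuclideanSpace ℝ (Fin 3)) (t, 0))) hpq
      rw [← ContinuousLinearMap.comp_apply, ← ContinuousLinearMap.comp_apply, hid] at h2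
      exact h2
    -- chain rule
    have hJcomp : J = (φ ∘ ν.toFun) ∘ Prod.map circlePt id := by
      funext q; rw [hJ, hνt]; rfl
    have hgd : MDifferentiableAt ((𝓡 1).prod 𝓘(ℝ, EuclideanSpace ℝ (Fin 3))) (𝓡 4)
        (φ ∘ ν.toFun) (circlePt t, 0) :=
      hJb.mdifferentiableAt (by simp)
    have hmf := mfderiv_comp (t, 0) (hgd : MDifferentiableAt
      ((𝓡 1).prod 𝓘(ℝ, EuclideanSpace ℝ (Fin 3))) (𝓡 4) (φ ∘ ν.toFun)
      (Prod.map circlePt (id : EuclideanSpace ℝ (Fin 3) → EuclideanSpace ℝ (Fin 3)) (t, 0))) hPd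
    rw [← RoundTube.mfderiv_prod_eq_fderiv J (t, 0), hJcomp, hmf]
    exact hLinj.comp hPinj
  have hT : fderiv ℝ J (t, 0) ((1 : ℝ), (0 : EuclideanSpace ℝ (Fin 3))) 1 = 0 ∧
      fderiv ℝ J (t, 0) ((1 : ℝ), (0 : EuclideanSpace ℝ (Fin 3))) 2 = 0 ∧
      fderiv ℝ J (t, 0) ((1 : ℝ), (0 : EuclideanSpace ℝ (Fin 3))) 3 = 0 := by
    -- the curve `s ↦ J (t + s, 0)` runs in the axis
    have hc : Continuous fun s : ℝ => νt (t + s, 0) :=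
      hνtM.continuous.comp (by fun_prop)
    have hev : ∀ᶠ s in 𝓝 (0 : ℝ), νt (t + s, 0) ∈ φ.source := by
      refine hc.continuousAt.preimage_mem_nhds ?_
      rw [add_zero]
      exact φ.open_source.mem_nhds hzsrc
    have haxis' : ∀ᶠ s in 𝓝 (0 : ℝ), J (t + s, 0) 1 = 0 ∧ J (t + s, 0) 2 = 0 ∧
        J (t + s, 0) 3 = 0 := by
      filter_upwards [hev] with s hs
      have hcrit_s : ¬ Surjective (mfderiv (𝓡 4) (𝓡 2) (Ψ ∘ f) (νt (t + s, 0))) := by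
        rw [surjective_mfderiv_diffeomorph_comp_iff Ψ (hfd _)]
        have hz : νt (t + s, 0) ∈ range e := by
          rw [hνt]; exact ⟨circlePt (t + s), (ν.apply_zero _).symm⟩
        rw [hrange] at hz
        exact hz.1
      have h1 := (not_iff_not.2 (surjective_mfderiv_iff_of_fold_chart hmaps (hφ.of_le h1')
        (hφs.of_le h1') (hψ.of_le h1') (hψs.of_le h1') hmodel hs (hf'd _))).1 hcrit_s
      rw [not_not] at h1
      rw [hJ]
      exact h1
    have hJfd : HasFDerivAt J (fderiv ℝ J (t, 0))
        ((fun s : ℝ => ((t + s, 0) : ℝ × EuclideanSpace ℝ (Fin 3))) 0) := by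
      simp only [add_zero]
      exact (hJs.differentiableAt (by simp)).hasFDerivAt
    have hcurve : HasDerivAt (fun s : ℝ => ((t + s, 0) : ℝ × EuclideanSpace ℝ (Fin 3)))
        ((1 : ℝ), (0 : EuclideanSpace ℝ (Fin 3))) 0 :=
      ((hasDerivAt_id (0 : ℝ)).const_add t).prodMk (hasDerivAt_const (0 : ℝ) _)
    have hJc : HasDerivAt (fun s : ℝ => J (t + s, 0))
        (fderiv ℝ J (t, 0) ((1 : ℝ), (0 : EuclideanSpace ℝ (Fin 3)))) 0 :=
      hJfd.comp_hasDerivAt 0 hcurve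
    -- the curve agrees near `0` with its projection to the axis
    let P : EuclideanSpace ℝ (Fin 4) →L[ℝ] EuclideanSpace ℝ (Fin 4) :=
      (EuclideanSpace.proj (0 : Fin 4)).smulRight (EuclideanSpace.single (0 : Fin 4) (1 : ℝ))
    have hP_apply : ∀ w : EuclideanSpace ℝ (Fin 4),
        P w = (w 0) • EuclideanSpace.single (0 : Fin 4) (1 : ℝ) := fun w => rfl
    have hPc : (fun s : ℝ => J (t + s, 0)) =ᶠ[𝓝 0] (P ∘ fun s : ℝ => J (t + s, 0)) := by
      filter_upwards [haxis'] with s hs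
      obtain ⟨h1, h2, h3⟩ := hs
      show J (t + s, 0) = P (J (t + s, 0))
      rw [hP_apply]
      ext i
      fin_cases i
      · simp
      · simpa using h1
      · simpa using h2
      · simpa using h3
    have hJc' : HasDerivAt (fun s : ℝ => J (t + s, 0))
        (P (fderiv ℝ J (t, 0) ((1 : ℝ), (0 : EuclideanSpace ℝ (Fin 3))))) 0 :=
      (P.hasFDerivAt.comp_hasDerivAt 0 hJc).congr_of_eventuallyEq hPc
    have hTP := hJc.unique hJc'
    rw [hP_apply] at hTP
    refine ⟨?_, ?_, ?_⟩
    · have := congrArg (fun w : EuclideanSpace ℝ (Fin 4) => w 1) hTP; simpa using this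
    · have := congrArg (fun w : EuclideanSpace ℝ (Fin 4) => w 2) hTP; simpa using this
    · have := congrArg (fun w : EuclideanSpace ℝ (Fin 4) => w 3) hTP; simpa using this
  have hT0 : fderiv ℝ J (t, 0) ((1 : ℝ), (0 : EuclideanSpace ℝ (Fin 3))) 0 ≠ 0 := by
    intro h0
    have hzero : fderiv ℝ J (t, 0) ((1 : ℝ), (0 : EuclideanSpace ℝ (Fin 3))) = 0 := by
      ext i
      fin_cases i
      · exact h0
      · exact hT.1
      · exact hT.2.1
      · exact hT.2.2
    have h1 : ((1 : ℝ), (0 : EuclideanSpace ℝ (Fin 3))) = 0 :=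
      hJinj (by rw [hzero, map_zero])
    simp at h1
  /- Step 11: the transversal differential `M a = (DJ (0, a))₁₂₃` is a linear automorphism. -/
  let Mₗ : EuclideanSpace ℝ (Fin 3) →ₗ[ℝ] EuclideanSpace ℝ (Fin 3) :=
    { toFun := fun a => WithLp.toLp 2 ![fderiv ℝ J (t, 0) ((0 : ℝ), a) 1,
        fderiv ℝ J (t, 0) ((0 : ℝ), a) 2, fderiv ℝ J (t, 0) ((0 : ℝ), a) 3]
      map_add' := fun a b => by
        have h1 : (((0 : ℝ), a + b) : ℝ × EuclideanSpace ℝ (Fin 3)) =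
            ((0 : ℝ), a) + ((0 : ℝ), b) := by simp
        rw [h1, map_add]
        ext i; fin_cases i <;> simp
      map_smul' := fun c a => by
        have h1 : (((0 : ℝ), c • a) : ℝ × EuclideanSpace ℝ (Fin 3)) = c • ((0 : ℝ), a) := by
          simp
        rw [h1, map_smul]
        ext i; fin_cases i <;> simp }
  have hMₗ_apply : ∀ a, Mₗ a = WithLp.toLp 2 ![fderiv ℝ J (t, 0) ((0 : ℝ), a) 1,
      fderiv ℝ J (t, 0) ((0 : ℝ), a) 2, fderiv ℝ J (t, 0) ((0 : ℝ), a) 3] := fun a => rfl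
  have hMinj : Injective Mₗ := by
    intro a b hab
    rw [← sub_eq_zero] at hab ⊢
    rw [← map_sub] at hab
    set d := a - b with hd
    have h1 : fderiv ℝ J (t, 0) ((0 : ℝ), d) 1 = 0 := by
      have := congrArg (fun w : EuclideanSpace ℝ (Fin 3) => w 0) hab; simpa [hMₗ_apply] using this
    have h2 : fderiv ℝ J (t, 0) ((0 : ℝ), d) 2 = 0 := by
      have := congrArg (fun w : EuclideanSpace ℝ (Fin 3) => w 1) hab; simpa [hMₗ_apply] using this
    have h3 : fderiv ℝ J (t, 0) ((0 : ℝ), d) 3 = 0 := by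
      have := congrArg (fun w : EuclideanSpace ℝ (Fin 3) => w 2) hab; simpa [hMₗ_apply] using this
    -- `DJ (0, d)` is a multiple of `DJ (1, 0)`
    set c : ℝ := fderiv ℝ J (t, 0) ((0 : ℝ), d) 0 /
      fderiv ℝ J (t, 0) ((1 : ℝ), (0 : EuclideanSpace ℝ (Fin 3))) 0 with hc
    have hprop : fderiv ℝ J (t, 0) ((0 : ℝ), d) =
        fderiv ℝ J (t, 0) ((c : ℝ), (0 : EuclideanSpace ℝ (Fin 3))) := by
      have hsm : (((c : ℝ), (0 : EuclideanSpace ℝ (Fin 3))) : ℝ × EuclideanSpace ℝ (Fin 3)) =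
          c • ((1 : ℝ), (0 : EuclideanSpace ℝ (Fin 3))) := by simp
      rw [hsm, map_smul]
      ext i
      fin_cases i
      · simp only [PiLp.smul_apply, smul_eq_mul]
        show fderiv ℝ J (t, 0) ((0 : ℝ), d) 0 = c * fderiv ℝ J (t, 0) ((1 : ℝ), 0) 0
        rw [hc, div_mul_cancel₀ _ hT0]
      · simp [h1, hT.1]
      · simp [h2, hT.2.1]
      · simp [h3, hT.2.2]
    have h4 := hJinj hprop
    have h5 := (Prod.mk.inj h4).2
    exact h5
  have hMsurj : Surjective Mₗ := (LinearMap.injective_iff_surjective).1 hMinj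
  let M : EuclideanSpace ℝ (Fin 3) ≃L[ℝ] EuclideanSpace ℝ (Fin 3) :=
    (LinearEquiv.ofBijective Mₗ ⟨hMinj, hMsurj⟩).toContinuousLinearEquiv
  have hM_apply : ∀ a, M a = WithLp.toLp 2 ![fderiv ℝ J (t, 0) ((0 : ℝ), a) 1,
      fderiv ℝ J (t, 0) ((0 : ℝ), a) 2, fderiv ℝ J (t, 0) ((0 : ℝ), a) 3] := fun a => rfl
  /- Step 12: assemble. -/
  refine ⟨hg0, hgd1, M, 2 * fderiv ℝ (ℓ ∘ ψ.symm) 0 (EuclideanSpace.single (1 : Fin 2) (1 : ℝ)),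
    hγpos, fun a b => ?_⟩
  rw [hD2g, hM_apply, hM_apply]
  simp
  ring

end IsSimplifiedBrokenLefschetzFibration

end Literature.Topology.FourManifolds
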